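import Summits.CriticalPhenomena.PercolationContinuityZ3.Theorems.FK.TranslationAveragesFK
import Summits.CriticalPhenomena.PercolationContinuityZ3.Theorems.FK.ClusterCountBoundaryCorrection
import HarnessLib

/-!
# FK-continuity cell, FO-10a: the `L¹` clause of Grimmett's (4.83) — the number of open clusters of the box per site,
# `k(ω,Λ_n)/|Λ_n|`, converges to `κ^b(p,q) = φ^b_{p,q}(|C_0|⁻¹)` in `L¹(φ^b_{p,q})`, hence in `φ^b_{p,q}`-probability

Registered R111 (cell INBOX l.7597, 2026-08-25); registry row FO-10a-g342; label LLN-C (coordinator fk-4 g228).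
Cell `fk-continuity` (bschramm), row FO-10a (pressure layer); support file for the FK-continuity transplant
(`--supports stmt-CriticalPhenomena-4575`); builds on p205010 (kernel theorem, internal audit signed; external expert
review pending). Pure proofs; no definitions, no named facts, no sorries; `0 ≤ p ≤ 1`, `q ≥ 1`, both boundary
conditions `b`, every `d` (`d ≥ 1` along boxes). UNCONDITIONAL infinite-volume structure; it decides nothing about
FH / TP_FK / the value of `p_c(q)`.

Grimmett 2006, (4.83), read here with `k(ω,Λ) = Σ_{x∈Λ} |C_x(ω ∩ E_Λ)|⁻¹` the number of open clusters of
`(Λ, ω ∩ E_Λ)` (the free box count; Grimmett's own `k(ω,Λ)` of (4.12)/p. 94 counts the clusters of `ω` meeting `Λ`,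
`Σ_{x∈Λ} |C_x(ω) ∩ Λ|⁻¹` — the two differ by at most `|∂Λ|` and (4.83) holds for both):
`k(ω,Λ)/|Λ| → φ(|C_0|⁻¹)` "`φ^b_{p,q}`-a.s. and in `L¹`, as `Λ ↑ ℤ^d`" (by the ergodic theorem). The tree
has the convergence IN MEAN (`ClusterCountBoundaryCorrection.lean`) and, from mixing (Cor. (4.23)) instead of the
ergodic theorem, the `L¹` law of large numbers `|Λ|⁻¹ Σ_{x∈Λ} |C_x(ω)|⁻¹ → κ^b` (`TranslationAveragesFK.lean`). Adding the
deterministic boundary correction `0 ≤ k(ω,Λ) − Σ_{x∈Λ} |C_x(ω)|⁻¹ ≤ |∂Λ|` (lattice `ω`) of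
`ClusterCountBoundaryCorrection.lean` gives the `L¹` CLAUSE of (4.83) along van Hove sequences and boxes, hence
convergence in probability; the ALMOST-SURE clause (pointwise ergodic theorem) is not claimed:

* `abs_avg_inv_ncard_inter_sub_le` — `| |Λ|⁻¹ k(ω,Λ) − κ | ≤ | |Λ|⁻¹ Σ_{x∈Λ} |C_x(ω)|⁻¹ − κ | + |∂Λ|/|Λ|` for lattice `ω`;
* **`tendsto_integral_abs_clusterCount_div_sub_kappa_of_vanHove`** — `∫ | k(ω,Λ_i)/|Λ_i| − κ^b(p,q) | dφ^b_{p,q} → 0` along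
  any finite `Λ_i` with `|Λ_i| → ∞` and `|∂Λ_i|/|Λ_i| → 0` (van Hove);
* **`tendsto_integral_abs_clusterCount_box_div_sub_kappa`** (boxes, `L¹`) and
  **`tendsto_rcLimit_real_le_abs_clusterCount_box_div_sub_kappa`** — in probability:
  `φ^b_{p,q}(| k(ω,Λ_n)/|Λ_n| − κ^b(p,q) | ≥ δ) → 0` for every `δ > 0`, `d ≥ 1`.

## References

* G. Grimmett, *The Random-Cluster Model*, Springer 2006 (`book:grimmett2006-random-cluster-model`): §4.5, proof of
  Lemma (4.79), displays after (4.82), and (4.83) [PDF p. 94]; Cor. (4.23) [PDF p. 79]. [Grimmett2006]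
-/

noncomputable section

open MeasureTheory Set Filter Finset
open scoped Topology ENNReal

namespace Summit.CriticalPhenomena.PercolationContinuityZ3.Theorems.FK

open Literature.Probability.Percolation Literature.Probability.LatticeModels

variable {d : ℕ} {p q : ℝ}

/-- **The boundary correction at the level of averages**: for a lattice configuration `ω` and every real `κ`,
`| |Λ|⁻¹ Σ_{x∈Λ} |C_x(ω ∩ E_Λ)|⁻¹ − κ | ≤ | |Λ|⁻¹ Σ_{x∈Λ} |C_x(ω)|⁻¹ − κ | + |∂Λ|/|Λ|`.
[cite: Grimmett2006, proof of Lemma (4.79), displays after (4.82)] -/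
theorem abs_avg_inv_ncard_inter_sub_le {ω : BondConfig (Site d)} (hω : ω ⊆ (zdGraph d).edgeSet)
    (Λ : Finset (Site d)) (κ : ℝ) :
    |(#Λ : ℝ)⁻¹ * ∑ x ∈ Λ, (((openCluster (ω ∩ ↑(edgesIn (zdGraph d) Λ)) x).ncard : ℝ))⁻¹ - κ| ≤
      |(#Λ : ℝ)⁻¹ * ∑ x ∈ Λ, (((openCluster ω x).ncard : ℝ))⁻¹ - κ| + #(innerBoundary (zdGraph d) Λ) / #Λ := by
  have h1 := sum_inv_ncard_le_sum_inv_ncard_inter ω Λ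
  have h2 := sum_inv_ncard_inter_sub_sum_inv_ncard_le_card_innerBoundary hω Λ
  rcases Nat.eq_zero_or_pos #Λ with h0 | hpos
  · rw [Finset.card_eq_zero.1 h0]; simp
  have hc : (0 : ℝ) < #Λ := by exact_mod_cast hpos
  have hdiff : |(#Λ : ℝ)⁻¹ * ∑ x ∈ Λ, (((openCluster (ω ∩ ↑(edgesIn (zdGraph d) Λ)) x).ncard : ℝ))⁻¹ -
      (#Λ : ℝ)⁻¹ * ∑ x ∈ Λ, (((openCluster ω x).ncard : ℝ))⁻¹| ≤ #(innerBoundary (zdGraph d) Λ) / #Λ := by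
    rw [← mul_sub, abs_mul, abs_of_nonneg (inv_nonneg.2 hc.le), abs_of_nonneg (by linarith), div_eq_inv_mul]
    exact mul_le_mul_of_nonneg_left h2 (inv_nonneg.2 hc.le)
  calc |(#Λ : ℝ)⁻¹ * ∑ x ∈ Λ, (((openCluster (ω ∩ ↑(edgesIn (zdGraph d) Λ)) x).ncard : ℝ))⁻¹ - κ|
      = |((#Λ : ℝ)⁻¹ * ∑ x ∈ Λ, (((openCluster ω x).ncard : ℝ))⁻¹ - κ) +
          ((#Λ : ℝ)⁻¹ * ∑ x ∈ Λ, (((openCluster (ω ∩ ↑(edgesIn (zdGraph d) Λ)) x).ncard : ℝ))⁻¹ -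
            (#Λ : ℝ)⁻¹ * ∑ x ∈ Λ, (((openCluster ω x).ncard : ℝ))⁻¹)| := by ring_nf
    _ ≤ _ := (abs_add_le _ _).trans (add_le_add le_rfl hdiff)

/-- **Grimmett 2006 (4.83) in `L¹(φ^b_{p,q})`, van Hove form**: along finite `Λ_i ⊆ ℤ^d` with `|Λ_i| → ∞` and
`|∂Λ_i|/|Λ_i| → 0`, `∫ | |Λ_i|⁻¹ k(ω,Λ_i) − κ^b(p,q) | dφ^b_{p,q} → 0`, where `k(ω,Λ) = Σ_{x∈Λ} |C_x(ω ∩ E_Λ)|⁻¹` is the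
number of open clusters of `(Λ, ω ∩ E_Λ)` and `κ^b(p,q) = ∫ |C_0|⁻¹ dφ^b_{p,q}`. [cite: Grimmett2006, §4.5 (4.83)] -/
theorem tendsto_integral_abs_clusterCount_div_sub_kappa_of_vanHove (b : Bool) (hp : p ∈ Set.Icc (0 : ℝ) 1)
    (hq : 1 ≤ q) {ι : Type*} {l : Filter ι} {Λ : ι → Finset (Site d)}
    (hΛ : Tendsto (fun i => (#(Λ i) : ℝ)) l atTop)
    (hvH : Tendsto (fun i => (#(innerBoundary (zdGraph d) (Λ i)) : ℝ) / #(Λ i)) l (𝓝 0)) :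
    Tendsto (fun i => ∫ ω, |(#(Λ i) : ℝ)⁻¹ *
        ∑ x ∈ Λ i, (((openCluster (ω ∩ ↑(edgesIn (zdGraph d) (Λ i))) x).ncard : ℝ))⁻¹ -
        ∫ ω', ((openCluster ω' (0 : Site d)).ncard : ℝ)⁻¹ ∂(rcLimit d b p q)| ∂(rcLimit d b p q)) l (𝓝 0) := by
  haveI := isProbabilityMeasure_rcLimit (d := d) b p q
  set P := rcLimit d b p q with hP
  set κ := ∫ ω', ((openCluster ω' (0 : Site d)).ncard : ℝ)⁻¹ ∂P with hκ
  have hlat := (isBoxLimit_rcLimit b hp hq (d := d)).ae_subset_edgeSet hp (one_pos.trans_le hq)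
  have hlim := (tendsto_integral_abs_avg_inv_ncard_sub_kappa b hp hq hΛ (d := d)).add hvH
  rw [add_zero] at hlim
  refine squeeze_zero (fun i => integral_nonneg fun ω => abs_nonneg _) (fun i => ?_) hlim
  have hint1 : Integrable (fun ω => |(#(Λ i) : ℝ)⁻¹ * ∑ x ∈ Λ i, (((openCluster ω x).ncard : ℝ))⁻¹ - κ|) P :=
    (((integrable_finsetSum _ fun x _ => integrable_inv_ncard_openCluster' x _).const_mul _).sub
      (integrable_const _)).abs
  calc ∫ ω, |(#(Λ i) : ℝ)⁻¹ * ∑ x ∈ Λ i, (((openCluster (ω ∩ ↑(edgesIn (zdGraph d) (Λ i))) x).ncard : ℝ))⁻¹ - κ| ∂P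
      ≤ ∫ ω, (|(#(Λ i) : ℝ)⁻¹ * ∑ x ∈ Λ i, (((openCluster ω x).ncard : ℝ))⁻¹ - κ| +
          #(innerBoundary (zdGraph d) (Λ i)) / #(Λ i)) ∂P :=
        integral_mono_of_nonneg (Eventually.of_forall fun ω => abs_nonneg _) (hint1.add (integrable_const _))
          (hlat.mono fun ω hω => abs_avg_inv_ncard_inter_sub_le hω (Λ i) κ)
    _ = ∫ ω, |(#(Λ i) : ℝ)⁻¹ * ∑ x ∈ Λ i, (((openCluster ω x).ncard : ℝ))⁻¹ - κ| ∂P +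
          #(innerBoundary (zdGraph d) (Λ i)) / #(Λ i) := by
        rw [integral_add hint1 (integrable_const _), integral_const, smul_eq_mul, probReal_univ, one_mul]

/-- **Grimmett 2006 (4.83) in `L¹(φ^b_{p,q})` along boxes**: `∫ | k(ω,Λ_n)/|Λ_n| − κ^b(p,q) | dφ^b_{p,q} → 0` (`d ≥ 1`).
[cite: Grimmett2006, §4.5 (4.83)] -/
theorem tendsto_integral_abs_clusterCount_box_div_sub_kappa (hd : 0 < d) (b : Bool) (hp : p ∈ Set.Icc (0 : ℝ) 1)
    (hq : 1 ≤ q) :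
    Tendsto (fun n : ℕ => ∫ ω, |(#(box d n) : ℝ)⁻¹ *
        ∑ x ∈ box d n, (((openCluster (ω ∩ ↑(edgesIn (zdGraph d) (box d n))) x).ncard : ℝ))⁻¹ -
        ∫ ω', ((openCluster ω' (0 : Site d)).ncard : ℝ)⁻¹ ∂(rcLimit d b p q)| ∂(rcLimit d b p q)) atTop (𝓝 0) :=
  tendsto_integral_abs_clusterCount_div_sub_kappa_of_vanHove b hp hq (tendsto_natCast_card_box_atTop hd)
    tendsto_card_innerBoundary_box_div_card_box

/-- **Grimmett 2006 (4.83) in probability: `φ^b_{p,q}(| k(ω,Λ_n)/|Λ_n| − κ^b(p,q) | ≥ δ) → 0`** for every `δ > 0`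
(`b ∈ {0,1}`, `0 ≤ p ≤ 1`, `q ≥ 1`, `d ≥ 1`), `k(ω,Λ_n)` the number of open clusters of `ω` restricted to the box.
[cite: Grimmett2006, §4.5 (4.83)] -/
theorem tendsto_rcLimit_real_le_abs_clusterCount_box_div_sub_kappa (hd : 0 < d) (b : Bool)
    (hp : p ∈ Set.Icc (0 : ℝ) 1) (hq : 1 ≤ q) {δ : ℝ} (hδ : 0 < δ) :
    Tendsto (fun n : ℕ => (rcLimit d b p q).real {ω | δ ≤ |(#(box d n) : ℝ)⁻¹ *
        ∑ x ∈ box d n, (((openCluster (ω ∩ ↑(edgesIn (zdGraph d) (box d n))) x).ncard : ℝ))⁻¹ -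
        ∫ ω', ((openCluster ω' (0 : Site d)).ncard : ℝ)⁻¹ ∂(rcLimit d b p q)|}) atTop (𝓝 0) := by
  haveI := isProbabilityMeasure_rcLimit (d := d) b p q
  refine tendsto_measureReal_le_abs_of_integral (fun n => ?_)
    (tendsto_integral_abs_clusterCount_box_div_sub_kappa hd b hp hq) hδ
  exact ((integrable_finsetSum _ fun x _ => integrable_inv_ncard_openCluster_inter x _ _).const_mul _).sub
    (integrable_const _)

/-- The van Hove form in probability: `φ^b_{p,q}(| k(ω,Λ_i)/|Λ_i| − κ^b(p,q) | ≥ δ) → 0` whenever `|Λ_i| → ∞` and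
`|∂Λ_i|/|Λ_i| → 0`. [cite: Grimmett2006, §4.5 (4.83)] -/
theorem tendsto_rcLimit_real_le_abs_clusterCount_div_sub_kappa_of_vanHove (b : Bool) (hp : p ∈ Set.Icc (0 : ℝ) 1)
    (hq : 1 ≤ q) {ι : Type*} {l : Filter ι} {Λ : ι → Finset (Site d)}
    (hΛ : Tendsto (fun i => (#(Λ i) : ℝ)) l atTop)
    (hvH : Tendsto (fun i => (#(innerBoundary (zdGraph d) (Λ i)) : ℝ) / #(Λ i)) l (𝓝 0)) {δ : ℝ} (hδ : 0 < δ) :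
    Tendsto (fun i => (rcLimit d b p q).real {ω | δ ≤ |(#(Λ i) : ℝ)⁻¹ *
        ∑ x ∈ Λ i, (((openCluster (ω ∩ ↑(edgesIn (zdGraph d) (Λ i))) x).ncard : ℝ))⁻¹ -
        ∫ ω', ((openCluster ω' (0 : Site d)).ncard : ℝ)⁻¹ ∂(rcLimit d b p q)|}) l (𝓝 0) := by
  haveI := isProbabilityMeasure_rcLimit (d := d) b p q
  refine tendsto_measureReal_le_abs_of_integral (fun i => ?_)
    (tendsto_integral_abs_clusterCount_div_sub_kappa_of_vanHove b hp hq hΛ hvH) hδ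
  exact ((integrable_finsetSum _ fun x _ => integrable_inv_ncard_openCluster_inter x _ _).const_mul _).sub
    (integrable_const _)

end Summit.CriticalPhenomena.PercolationContinuityZ3.Theorems.FK

end
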